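import Literature.Probability.LatticeModels.KCMeshVisibility
import Literature.Probability.LatticeModels.KCTwoPointFamily
import HarnessLib

/-!
# Families of spin-fermion data with background spins, IV ter: the Dirichlet boundary condition under
# `MeshApproximates`

Topic `Literature/Probability/LatticeModels`. The boundary smallness theorems of
`KCSectionFamilyBoundary.lean` / `KCSectionFamilyBoundaryHb.lean` (Chelkak–Hongler–Izyurov 2015,
§3.4 (3.20), property (1) of Prop. 3.9) with their visibility hypothesis (a frozen site within `C₀δ`
of every point of `Ωᶜ`) replaced by CHI's standing approximation hypothesis `MeshApproximates Ω`:
by `eventually_exists_not_mem_near_frontier` (`KCMeshVisibility.lean`) every boundary point of `Ω` is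
eventually within `d` of a non-free site, which is all the decay argument needs (the frozen site is
then within `2d + O(δ)` of the collar cell, found through the nearest boundary point
`exists_mem_frontier_infDist_compl_eq_dist`). **`KCSectionFamily.boundary_smallness_mesh`** (white:
`|Hw - c| ≤ ηMN` on the `d`-collar) and **`KCSectionFamily.boundary_smallness_hb_mesh`** (black:
`Hb ≤ c + ηMN` at the touching plaquettes of the `d`-collar), for families whose volumes are free sites
(`Λ δ ⊆ meshInteriorFinset Ω δ`). Everything is proved; no named fact.

## References

* D. Chelkak, C. Hongler, K. Izyurov, Ann. of Math. 181 (2015), §2.1, §3.4 (3.20), Prop. 3.9 (1)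
  [ChelkakHonglerIzyurovAnnals2015].
* D. Chelkak, S. Smirnov, Invent. Math. 189 (2012), proof of Thm. 6.1 [ChelkakSmirnov2012Ising].
-/

noncomputable section

namespace Literature.Probability.LatticeModels

open Complex Filter Metric Set _root_.Topology Finset SimpleGraph WeakBeurling

namespace KCSectionFamily

variable (𝓕 : KCSectionFamily) {Ω : Set ℂ}

/-- **The Dirichlet boundary condition of the Kadanoff–Ceva primitive along the mesh, under
`MeshApproximates`** (CHI15 §3.4 (3.20) with the weak Beurling estimate): under the a-priori bound on
the collar, `Hw δ - c δ` is `η`-small relative to the bound at the free sites within `d = d(η)` of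
`Ωᶜ`, for all small `δ`. [cite: ChelkakHonglerIzyurovAnnals2015, §3.4 (3.20) and Prop. 3.9 (1)] -/
theorem boundary_smallness_mesh (hΩc : Ωᶜ.Nonempty) (hΩo : IsOpen Ω) (hΩb : Bornology.IsBounded Ω) (hΩne : Ω.Nonempty)
    (hMA : MeshApproximates Ω)
    (hadj : ∀ᶠ δ in 𝓝[>] (0 : ℝ), ∀ v ∈ 𝓕.Λ δ, ∀ k : Fin 4, (discreteDomainGraph Ω δ).Adj v (v + cornerUnit k))
    (hcuts : ∀ᶠ δ in 𝓝[>] (0 : ℝ),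
      IsKCCuts (discreteDomainGraph Ω δ) (𝓕.Λ δ) (𝓕.cut δ) ↑(fillFinset (touchPlaquettes (𝓕.Λ δ))))
    (hprim : ∀ᶠ δ in 𝓝[>] (0 : ℝ), IsKCPrimitive (discreteDomainGraph Ω δ) (𝓕.Λ δ) criticalBetaTwo (.fixed 1) (𝓕.B δ)
      (𝓕.cut δ) (𝓕.Hw δ) (𝓕.Hb δ) ↑(fillFinset (touchPlaquettes (𝓕.Λ δ))))
    (hHF : ∀ᶠ δ in 𝓝[>] (0 : ℝ), HoleFree (↑(𝓕.Λ δ) : Set (Site 2)))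
    {p₀ : ℝ → Site 2}
    (hodd : ∀ᶠ δ in 𝓝[>] (0 : ℝ), ∀ p ∈ touchPlaquettes (𝓕.Λ δ), p ≠ p₀ δ →
      Odd #(Finset.univ.filter fun j : Fin 4 => plaqSide p j ∈ 𝓕.cut δ p))
    {c : ℝ → ℝ}
    (hcst : ∀ᶠ δ in 𝓝[>] (0 : ℝ), ∀ (v : Site 2) (k : Fin 4), v ∉ 𝓕.Λ δ →
      faceAt v k ∈ fillFinset (touchPlaquettes (𝓕.Λ δ)) → 𝓕.Hw δ v = c δ)
    (hΛsub : ∀ᶠ δ in 𝓝[>] (0 : ℝ), 𝓕.Λ δ ⊆ meshInteriorFinset Ω δ)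
    {ε₁ : ℝ} (hε₁ : 0 < ε₁)
    (hfar : ∀ᶠ δ in 𝓝[>] (0 : ℝ), (∀ b ∈ 𝓕.B δ, 2 * ε₁ ≤ infDist (meshPoint δ b) Ωᶜ) ∧
      2 * ε₁ ≤ infDist (meshPoint δ (p₀ δ)) Ωᶜ)
    {M : ℝ} (hM : 0 < M) {N : ℝ → ℝ} (hN : ∀ᶠ δ in 𝓝[>] (0 : ℝ), 0 < N δ)
    (hapriori : ∀ᶠ δ in 𝓝[>] (0 : ℝ), ∀ y : Site 2, infDist (meshPoint δ y) Ωᶜ ≤ ε₁ →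
      (y ∈ 𝓕.Λ δ → |𝓕.Hw δ y - c δ| ≤ M * N δ) ∧ (y ∈ touchPlaquettes (𝓕.Λ δ) → |𝓕.Hb δ y - c δ| ≤ M * N δ)) :
    ∀ η > 0, ∃ d > 0, ∀ᶠ δ in 𝓝[>] (0 : ℝ), ∀ y ∈ 𝓕.Λ δ, infDist (meshPoint δ y) Ωᶜ ≤ d →
      |𝓕.Hw δ y - c δ| ≤ η * (M * N δ) := by
  intro η hη
  -- the ratio factor and the choice of `d`
  obtain ⟨κ, hκ⟩ : ∃ κ : ℝ, κ = 8 * ((1 : ℝ) + 5) / ε₁ := ⟨_, rfl⟩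
  have hC₀ : (0 : ℝ) < (1 : ℝ) := by norm_num
  have hκ0 : 0 < κ := by rw [hκ]; positivity
  have hlimd := tendsto_decay_profiles κ
  have hevd : ∀ᶠ d in 𝓝[>] (0 : ℝ),
      beurlingConst * (κ * d) ^ beurlingExp + endDecayConst * (κ * d) ^ endDecayExp < η ∧ d < ε₁ / 16 := by
    have h1 : ∀ᶠ d in 𝓝 (0 : ℝ), beurlingConst * (κ * d) ^ beurlingExp + endDecayConst * (κ * d) ^ endDecayExp < η :=
      hlimd (Iio_mem_nhds hη)
    have h2 : ∀ᶠ d in 𝓝 (0 : ℝ), d < ε₁ / 16 := Iio_mem_nhds (by positivity)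
    exact mem_nhdsWithin_of_mem_nhds (h1.and h2)
  obtain ⟨d, ⟨hdη, hdε⟩, hd0⟩ := (hevd.and self_mem_nhdsWithin).exists
  have hd0 : (0 : ℝ) < d := hd0
  refine ⟨d, hd0, ?_⟩
  have hC := one_le_beurlingConst
  have hA := endDecayConst_pos
  have hβ := beurlingExp_pos
  have hγ := endDecayExp_pos
  have hvisd := eventually_exists_not_mem_near_frontier hΩb hΩne hMA hd0
  have hδev : ∀ᶠ δ in 𝓝[>] (0 : ℝ), δ < min d (ε₁ / (16 * ((1 : ℝ) + 5))) :=
    mem_nhdsWithin_of_mem_nhds (Iio_mem_nhds (by positivity))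
  filter_upwards [hadj, hcuts, hprim, hHF, hodd, hcst, hvisd, hΛsub, hfar, hN, hapriori, hδev, self_mem_nhdsWithin]
    with δ hadj hcuts hprim hHF hodd hcst hvis hΛsub hfar hN hapriori hδ hδ0
  intro y hy hyd
  have hδ0 : (0 : ℝ) < δ := hδ0
  have hδd : δ < d := hδ.trans_le (min_le_left _ _)
  have hδε : δ < ε₁ / (16 * ((1 : ℝ) + 5)) := hδ.trans_le (min_le_right _ _)
  have hδε' : δ * (16 * ((1 : ℝ) + 5)) < ε₁ := by rwa [lt_div_iff₀ (by positivity)] at hδε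
  have hδε'' : ((1 : ℝ) + 5) * δ < ε₁ / 16 := by rw [lt_div_iff₀ (by norm_num)]; linarith
  have hle : discreteDomainGraph Ω δ ≤ zdGraph 2 := discreteDomainGraph_le_zdGraph Ω δ
  -- a point of `Ωᶜ` within `2d` of `y`, a frozen site `p` within `C₀ δ` of it, a frozen neighbour
  have hΩuniv : Ω ≠ univ := fun h => by obtain ⟨w, hw⟩ := hΩc; rw [h, compl_univ] at hw; exact hw
  have hyΩ : meshPoint δ y ∈ Ω := meshPoint_mem_of_mem_meshInteriorFinset hΩb hδ0 (hΛsub hy)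
  obtain ⟨w, hwfr, hyw'⟩ := exists_mem_frontier_infDist_compl_eq_dist hyΩ hΩuniv
  have hwΩ : w ∈ Ωᶜ := fun hwΩ' => by
    have := hΩo.inter_frontier_eq; exact (Set.ext_iff.1 this w).1 ⟨hwΩ', hwfr⟩
  obtain ⟨p, hpI, hpw'⟩ := hvis w hwfr
  have hpΛ : p ∉ 𝓕.Λ δ := fun hp => hpI (hΛsub hp)
  have hpw : dist (meshPoint δ p) w ≤ (1 : ℝ) * δ + d := by linarith
  obtain ⟨k₀, hk₀⟩ := exists_frozen_neighbour hHF hpΛ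
  have hyp : dist (meshPoint δ y) (meshPoint δ p) ≤ 2 * d + (1 : ℝ) * δ := by
    have := dist_triangle (meshPoint δ y) w (meshPoint δ p)
    rw [dist_comm w] at this
    have h0 : dist (meshPoint δ y) w ≤ d := by rw [← hyw']; exact hyd
    nlinarith [hδ0.le]
  -- the lattice radii
  obtain ⟨R, hRdef⟩ : ∃ R : ℕ, R = ⌊ε₁ / (4 * δ)⌋₊ := ⟨_, rfl⟩
  obtain ⟨ρ, hρdef⟩ : ∃ ρ : ℕ, ρ = ⌈(2 * d + (1 : ℝ) * δ) / δ⌉₊ := ⟨_, rfl⟩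
  have hq0 : 0 ≤ ε₁ / (4 * δ) := by positivity
  have hRle : (R : ℝ) ≤ ε₁ / (4 * δ) := hRdef ▸ Nat.floor_le hq0
  have hRlt : ε₁ / (4 * δ) < (R : ℝ) + 1 := hRdef ▸ Nat.lt_floor_add_one _
  have hρge : (2 * d + (1 : ℝ) * δ) / δ ≤ (ρ : ℝ) := hρdef ▸ Nat.le_ceil _
  have hρlt : (ρ : ℝ) < (2 * d + (1 : ℝ) * δ) / δ + 1 := hρdef ▸ Nat.ceil_lt_add_one (by positivity)
  -- `ρ + 3 ≤ R`
  have hρR_real : (ρ : ℝ) + 3 ≤ (R : ℝ) := aux_rho_add_three_le hδ0 hε₁ hdε hδε'' hρlt hRlt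
  have hρR : ρ + 3 ≤ R := by exact_mod_cast hρR_real
  -- `y ∈ sqBox p ρ`
  have hyρ : y ∈ sqBox p ρ := by
    refine mem_sqBox_of_dist_meshPoint_le hδ0 (hyp.trans ?_)
    have : (2 * d + (1 : ℝ) * δ) = δ * ((2 * d + (1 : ℝ) * δ) / δ) := by field_simp
    rw [this]; push_cast
    exact mul_le_mul_of_nonneg_left hρge hδ0.le
  -- the collar: boxes of radius `R + 1` about `p` are within `ε₁` of `Ωᶜ`
  have hcollar0 := aux_collar_le hδ0 hC₀ hδε'' hRle
  have hslack : 2 * δ * ((R : ℝ) + 1) + (1 : ℝ) * δ + d ≤ ε₁ := by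
    have h1 : 2 * δ * (R : ℝ) ≤ ε₁ / 2 := by
      have := mul_le_mul_of_nonneg_left hRle (by positivity : (0 : ℝ) ≤ 2 * δ)
      rwa [show 2 * δ * (ε₁ / (4 * δ)) = ε₁ / 2 by field_simp; ring] at this
    nlinarith
  have hcollar : ∀ q : Site 2, q ∈ sqBox p ((R : ℤ) + 1) → infDist (meshPoint δ q) Ωᶜ ≤ ε₁ := by
    intro q hq
    have h1 : dist (meshPoint δ q) (meshPoint δ p) ≤ 2 * δ * ((R : ℝ) + 1) := by
      have := dist_meshPoint_le_two_mul_of_mem_sqBox hδ0.le hq; push_cast at this; exact this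
    have h2 := dist_triangle (meshPoint δ q) (meshPoint δ p) w
    exact (infDist_le_dist_of_mem hwΩ).trans (by linarith)
  -- the background spins and the source are outside `sqBox p R`
  have hBfar : ∀ b ∈ 𝓕.B δ, b ∉ sqBox p R := fun b hb hbR => by
    have h1 := hcollar b (sqBox_mono p (by omega) hbR)
    have h2 := hfar.1 b hb
    linarith
  set c₀ : Site 2 := faceAt p k₀ with hc₀def
  have hp₀far : p₀ δ ∉ sqBox c₀ ((R - 1 : ℕ) : ℤ) := fun hin => by
    have h0 : ((R - 1 : ℕ) : ℤ) + 1 ≤ (R : ℤ) + 1 := by omega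
    have h1 := hcollar (p₀ δ) (sqBox_mono p h0 (sqBox_faceAt_subset p k₀ _ hin))
    linarith [hfar.2]
  -- LOWER bound at `y`
  have hMN : 0 < M * N δ := mul_pos hM hN
  have hlow := hprim.le_hw_near_frozen hadj hle hcuts hHF hpΛ hBfar (c := c δ) (m := c δ - M * N δ) (by linarith) hcst
    (fun w' hw' hw'R hw'R1 => by
      have := ((hapriori w' (hcollar w' hw'R1)).1 hw')
      rw [abs_le] at this; linarith) (show ρ ≤ R by omega) hy hyρ
  -- UPPER bound at `y` through `Hb (faceAt y 0) = Hb y`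
  have hyt : y ∈ touchPlaquettes (𝓕.Λ δ) := by simpa [faceAt_zero_eq] using faceAt_mem_touchPlaquettes hy 0
  have hyρ' : y ∈ sqBox c₀ ((ρ + 1 : ℕ) : ℤ) := by
    have := sqBox_subset_sqBox_faceAt p k₀ (ρ : ℤ) hyρ; push_cast; exact this
  have hbd : ∀ q ∈ touchPlaquettes (𝓕.Λ δ), q ∈ sqBox c₀ (((R - 1 : ℕ) : ℤ) + 1) → 𝓕.Hb δ q ≤ c δ + M * N δ := by
    intro q hq hqbox
    have h0 : ((R - 1 : ℕ) : ℤ) + 1 + 1 ≤ (R : ℤ) + 1 := by omega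
    have h1 := hcollar q (sqBox_mono p h0 (sqBox_faceAt_subset p k₀ _ hqbox))
    have := (hapriori q h1).2 hq
    rw [abs_le] at this; linarith
  have hup := hprim.hb_le_near_frozen hadj (fun _ _ => rfl) hcuts hHF hodd hcst hpΛ hk₀ (Or.inl rfl) hp₀far hMN hbd
    (show ρ + 1 ≤ R - 1 by omega) hyt hyρ'
  have hwb : 𝓕.Hw δ y ≤ 𝓕.Hb δ y := by
    have := hprim.hw_le_hb _ (Finset.mem_coe.2 (subset_fillFinset _ (faceAt_mem_touchPlaquettes hy 0)))
    rwa [faceAt_zero_eq] at this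
  -- the ratios are at most `κ d`
  have hR3 : 3 ≤ R := le_trans (by omega) hρR
  have hRbig : ε₁ / (8 * δ) ≤ (R : ℝ) := by
    have h1 : ε₁ / (4 * δ) - 1 ≤ (R : ℝ) := by linarith
    have h2 : 1 ≤ ε₁ / (8 * δ) := by
      rw [le_div_iff₀ (by positivity)]; nlinarith
    have h3 : ε₁ / (4 * δ) = 2 * (ε₁ / (8 * δ)) := by field_simp; ring
    linarith
  have hratio : ∀ x : ℝ, 0 ≤ x → x ≤ (ρ : ℝ) + 2 → ∀ z : ℝ, ε₁ / (8 * δ) ≤ z → x / z ≤ κ * d := by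
    intro x _ hx z hz
    rw [hκ]
    exact aux_ratio_le hδ0 hC₀ hε₁ hd0 hδd hρlt hx hz
  have hr1 : (((ρ : ℝ) + 1) / ((R : ℝ) + 1)) ≤ κ * d :=
    hratio _ (by positivity) (by linarith) _ (by linarith)
  have hr2 : ((((ρ + 1 : ℕ) : ℝ) + 1) / (((R - 1 : ℕ) : ℝ) + 1)) ≤ κ * d := by
    have e : (((R - 1 : ℕ) : ℝ) + 1) = (R : ℝ) := by
      rw [Nat.cast_sub (by omega)]; push_cast; ring
    rw [e]
    exact hratio _ (by positivity) (by push_cast; linarith) _ hRbig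
  have hpow1 : beurlingConst * (((ρ : ℝ) + 1) / ((R : ℝ) + 1)) ^ beurlingExp ≤ beurlingConst * (κ * d) ^ beurlingExp :=
    mul_le_mul_of_nonneg_left (Real.rpow_le_rpow (by positivity) hr1 hβ.le) (by linarith)
  have hpow2 : endDecayConst * endProfile (R - 1) (ρ + 1) ≤ endDecayConst * (κ * d) ^ endDecayExp :=
    mul_le_mul_of_nonneg_left (Real.rpow_le_rpow (by positivity) hr2 hγ.le) hA.le
  have hpos1 : 0 ≤ beurlingConst * (((ρ : ℝ) + 1) / ((R : ℝ) + 1)) ^ beurlingExp := by positivity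
  have hpos2 : 0 ≤ endDecayConst * endProfile (R - 1) (ρ + 1) := mul_nonneg hA.le (endProfile_pos _ _).le
  have hposκ1 : 0 ≤ beurlingConst * (κ * d) ^ beurlingExp := by positivity
  have hposκ2 : 0 ≤ endDecayConst * (κ * d) ^ endDecayExp := by positivity
  have hX1 : beurlingConst * (((ρ : ℝ) + 1) / ((R : ℝ) + 1)) ^ beurlingExp ≤ η := by linarith
  have hX2 : endDecayConst * endProfile (R - 1) (ρ + 1) ≤ η := by linarith
  have hm1 := mul_le_mul_of_nonneg_left hX1 hMN.le
  have hm2 := mul_le_mul_of_nonneg_left hX2 hMN.le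
  -- conclusion
  rw [abs_le]
  constructor
  · -- lower
    have h' : c δ - (c δ - (c δ - M * N δ)) * (beurlingConst * (((ρ : ℝ) + 1) / ((R : ℝ) + 1)) ^ beurlingExp) ≤ 𝓕.Hw δ y := hlow
    have e : c δ - (c δ - (c δ - M * N δ)) * (beurlingConst * (((ρ : ℝ) + 1) / ((R : ℝ) + 1)) ^ beurlingExp) =
        c δ - M * N δ * (beurlingConst * (((ρ : ℝ) + 1) / ((R : ℝ) + 1)) ^ beurlingExp) := by ring
    rw [e] at h'
    linarith
  · -- upper
    linarith

/-- **The black primitive is at most `c + ηMN` near the boundary, under `MeshApproximates`.** [cite: ChelkakHonglerIzyurovAnnals2015, §3.4 (3.20) and Prop. 3.9 (1)] -/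
theorem boundary_smallness_hb_mesh (hΩc : Ωᶜ.Nonempty) (hΩo : IsOpen Ω) (hΩb : Bornology.IsBounded Ω) (hΩne : Ω.Nonempty)
    (hMA : MeshApproximates Ω)
    (hadj : ∀ᶠ δ in 𝓝[>] (0 : ℝ), ∀ v ∈ 𝓕.Λ δ, ∀ k : Fin 4, (discreteDomainGraph Ω δ).Adj v (v + cornerUnit k))
    (hcuts : ∀ᶠ δ in 𝓝[>] (0 : ℝ),
      IsKCCuts (discreteDomainGraph Ω δ) (𝓕.Λ δ) (𝓕.cut δ) ↑(fillFinset (touchPlaquettes (𝓕.Λ δ))))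
    (hprim : ∀ᶠ δ in 𝓝[>] (0 : ℝ), IsKCPrimitive (discreteDomainGraph Ω δ) (𝓕.Λ δ) criticalBetaTwo (.fixed 1) (𝓕.B δ)
      (𝓕.cut δ) (𝓕.Hw δ) (𝓕.Hb δ) ↑(fillFinset (touchPlaquettes (𝓕.Λ δ))))
    (hHF : ∀ᶠ δ in 𝓝[>] (0 : ℝ), HoleFree (↑(𝓕.Λ δ) : Set (Site 2)))
    {p₀ : ℝ → Site 2}
    (hodd : ∀ᶠ δ in 𝓝[>] (0 : ℝ), ∀ p ∈ touchPlaquettes (𝓕.Λ δ), p ≠ p₀ δ →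
      Odd #(Finset.univ.filter fun j : Fin 4 => plaqSide p j ∈ 𝓕.cut δ p))
    {c : ℝ → ℝ}
    (hcst : ∀ᶠ δ in 𝓝[>] (0 : ℝ), ∀ (v : Site 2) (k : Fin 4), v ∉ 𝓕.Λ δ →
      faceAt v k ∈ fillFinset (touchPlaquettes (𝓕.Λ δ)) → 𝓕.Hw δ v = c δ)
    (hΛsub : ∀ᶠ δ in 𝓝[>] (0 : ℝ), 𝓕.Λ δ ⊆ meshInteriorFinset Ω δ)
    {ε₁ : ℝ} (hε₁ : 0 < ε₁)
    (hfar : ∀ᶠ δ in 𝓝[>] (0 : ℝ), (∀ b ∈ 𝓕.B δ, 2 * ε₁ ≤ infDist (meshPoint δ b) Ωᶜ) ∧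
      2 * ε₁ ≤ infDist (meshPoint δ (p₀ δ)) Ωᶜ)
    {M : ℝ} (hM : 0 < M) {N : ℝ → ℝ} (hN : ∀ᶠ δ in 𝓝[>] (0 : ℝ), 0 < N δ)
    (hapriori : ∀ᶠ δ in 𝓝[>] (0 : ℝ), ∀ y : Site 2, infDist (meshPoint δ y) Ωᶜ ≤ ε₁ →
      (y ∈ 𝓕.Λ δ → |𝓕.Hw δ y - c δ| ≤ M * N δ) ∧ (y ∈ touchPlaquettes (𝓕.Λ δ) → |𝓕.Hb δ y - c δ| ≤ M * N δ)) :
    ∀ η > 0, ∃ d > 0, ∀ᶠ δ in 𝓝[>] (0 : ℝ), ∀ y ∈ touchPlaquettes (𝓕.Λ δ), infDist (meshPoint δ y) Ωᶜ ≤ d →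
      𝓕.Hb δ y ≤ c δ + η * (M * N δ) := by
  intro η hη
  -- the ratio factor and the choice of `d`
  obtain ⟨κ, hκ⟩ : ∃ κ : ℝ, κ = 8 * ((4 : ℝ) + 5) / ε₁ := ⟨_, rfl⟩
  have hC₀ : (0 : ℝ) < (4 : ℝ) := by norm_num
  have hκ0 : 0 < κ := by rw [hκ]; positivity
  have hlimd := tendsto_decay_profiles κ
  have hevd : ∀ᶠ d in 𝓝[>] (0 : ℝ),
      beurlingConst * (κ * d) ^ beurlingExp + endDecayConst * (κ * d) ^ endDecayExp < η ∧ d < ε₁ / 16 := by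
    have h1 : ∀ᶠ d in 𝓝 (0 : ℝ), beurlingConst * (κ * d) ^ beurlingExp + endDecayConst * (κ * d) ^ endDecayExp < η :=
      hlimd (Iio_mem_nhds hη)
    have h2 : ∀ᶠ d in 𝓝 (0 : ℝ), d < ε₁ / 16 := Iio_mem_nhds (by positivity)
    exact mem_nhdsWithin_of_mem_nhds (h1.and h2)
  obtain ⟨d, ⟨hdη, hdε⟩, hd0⟩ := (hevd.and self_mem_nhdsWithin).exists
  have hd0 : (0 : ℝ) < d := hd0
  refine ⟨d, hd0, ?_⟩
  have hC := one_le_beurlingConst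
  have hA := endDecayConst_pos
  have hβ := beurlingExp_pos
  have hγ := endDecayExp_pos
  have hvisd := eventually_exists_not_mem_near_frontier hΩb hΩne hMA hd0
  have hδev : ∀ᶠ δ in 𝓝[>] (0 : ℝ), δ < min d (ε₁ / (16 * ((4 : ℝ) + 5))) :=
    mem_nhdsWithin_of_mem_nhds (Iio_mem_nhds (by positivity))
  filter_upwards [hadj, hcuts, hprim, hHF, hodd, hcst, hvisd, hΛsub, hfar, hN, hapriori, hδev, self_mem_nhdsWithin]
    with δ hadj hcuts hprim hHF hodd hcst hvis hΛsub hfar hN hapriori hδ hδ0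
  intro y hyt hyd
  have hδ0 : (0 : ℝ) < δ := hδ0
  have hδd : δ < d := hδ.trans_le (min_le_left _ _)
  have hδε : δ < ε₁ / (16 * ((4 : ℝ) + 5)) := hδ.trans_le (min_le_right _ _)
  have hδε' : δ * (16 * ((4 : ℝ) + 5)) < ε₁ := by rwa [lt_div_iff₀ (by positivity)] at hδε
  have hδε'' : ((4 : ℝ) + 5) * δ < ε₁ / 16 := by rw [lt_div_iff₀ (by norm_num)]; linarith
  have hle : discreteDomainGraph Ω δ ≤ zdGraph 2 := discreteDomainGraph_le_zdGraph Ω δ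
  -- a point of `Ωᶜ` within `2d` of `y`, a frozen site `p` within `C₀ δ` of it, a frozen neighbour
  have hΩuniv : Ω ≠ univ := fun h => by obtain ⟨w, hw⟩ := hΩc; rw [h, compl_univ] at hw; exact hw
  obtain ⟨v, hvΛ, kv, hvk⟩ := mem_touchPlaquettes.1 hyt
  have hvy : v = y + cornerOff kv := by rw [← hvk, faceAt, sub_add_cancel]
  have hdyv : dist (meshPoint δ v) (meshPoint δ y) ≤ 2 * δ := by
    rw [hvy]; exact dist_meshPoint_add_le hδ0.le y (cornerOff kv) (abs_cornerOff_apply_le kv 0) (abs_cornerOff_apply_le kv 1)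
  have hvΩ : meshPoint δ v ∈ Ω := meshPoint_mem_of_mem_meshInteriorFinset hΩb hδ0 (hΛsub hvΛ)
  obtain ⟨w, hwfr, hvw'⟩ := exists_mem_frontier_infDist_compl_eq_dist hvΩ hΩuniv
  have hwΩ : w ∈ Ωᶜ := fun hwΩ' => by
    have := hΩo.inter_frontier_eq; exact (Set.ext_iff.1 this w).1 ⟨hwΩ', hwfr⟩
  have hvd : infDist (meshPoint δ v) Ωᶜ ≤ d + 2 * δ := by
    have := Metric.infDist_le_infDist_add_dist (s := Ωᶜ) (x := meshPoint δ v) (y := meshPoint δ y)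
    linarith
  obtain ⟨p, hpI, hpw'⟩ := hvis w hwfr
  have hpΛ : p ∉ 𝓕.Λ δ := fun hp => hpI (hΛsub hp)
  have hpw : dist (meshPoint δ p) w ≤ (4 : ℝ) * δ + d := by linarith
  obtain ⟨k₀, hk₀⟩ := exists_frozen_neighbour hHF hpΛ
  have hyp : dist (meshPoint δ y) (meshPoint δ p) ≤ 2 * d + (4 : ℝ) * δ := by
    have h1 := dist_triangle (meshPoint δ y) (meshPoint δ v) w
    have h2 := dist_triangle (meshPoint δ y) w (meshPoint δ p)
    rw [dist_comm w] at h2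
    rw [dist_comm (meshPoint δ y) (meshPoint δ v)] at h1
    have h0 : dist (meshPoint δ v) w ≤ d + 2 * δ := by rw [← hvw']; exact hvd
    linarith
  -- the lattice radii
  obtain ⟨R, hRdef⟩ : ∃ R : ℕ, R = ⌊ε₁ / (4 * δ)⌋₊ := ⟨_, rfl⟩
  obtain ⟨ρ, hρdef⟩ : ∃ ρ : ℕ, ρ = ⌈(2 * d + (4 : ℝ) * δ) / δ⌉₊ := ⟨_, rfl⟩
  have hq0 : 0 ≤ ε₁ / (4 * δ) := by positivity
  have hRle : (R : ℝ) ≤ ε₁ / (4 * δ) := hRdef ▸ Nat.floor_le hq0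
  have hRlt : ε₁ / (4 * δ) < (R : ℝ) + 1 := hRdef ▸ Nat.lt_floor_add_one _
  have hρge : (2 * d + (4 : ℝ) * δ) / δ ≤ (ρ : ℝ) := hρdef ▸ Nat.le_ceil _
  have hρlt : (ρ : ℝ) < (2 * d + (4 : ℝ) * δ) / δ + 1 := hρdef ▸ Nat.ceil_lt_add_one (by positivity)
  -- `ρ + 3 ≤ R`
  have hρR_real : (ρ : ℝ) + 3 ≤ (R : ℝ) := aux_rho_add_three_le hδ0 hε₁ hdε hδε'' hρlt hRlt
  have hρR : ρ + 3 ≤ R := by exact_mod_cast hρR_real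
  -- `y ∈ sqBox p ρ`
  have hyρ : y ∈ sqBox p ρ := by
    refine mem_sqBox_of_dist_meshPoint_le hδ0 (hyp.trans ?_)
    have : (2 * d + (4 : ℝ) * δ) = δ * ((2 * d + (4 : ℝ) * δ) / δ) := by field_simp
    rw [this]; push_cast
    exact mul_le_mul_of_nonneg_left hρge hδ0.le
  -- the collar: boxes of radius `R + 1` about `p` are within `ε₁` of `Ωᶜ`
  have hcollar0 := aux_collar_le hδ0 hC₀ hδε'' hRle
  have hslack : 2 * δ * ((R : ℝ) + 1) + (4 : ℝ) * δ + d ≤ ε₁ := by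
    have h1 : 2 * δ * (R : ℝ) ≤ ε₁ / 2 := by
      have := mul_le_mul_of_nonneg_left hRle (by positivity : (0 : ℝ) ≤ 2 * δ)
      rwa [show 2 * δ * (ε₁ / (4 * δ)) = ε₁ / 2 by field_simp; ring] at this
    nlinarith
  have hcollar : ∀ q : Site 2, q ∈ sqBox p ((R : ℤ) + 1) → infDist (meshPoint δ q) Ωᶜ ≤ ε₁ := by
    intro q hq
    have h1 : dist (meshPoint δ q) (meshPoint δ p) ≤ 2 * δ * ((R : ℝ) + 1) := by
      have := dist_meshPoint_le_two_mul_of_mem_sqBox hδ0.le hq; push_cast at this; exact this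
    have h2 := dist_triangle (meshPoint δ q) (meshPoint δ p) w
    exact (infDist_le_dist_of_mem hwΩ).trans (by linarith)
  -- the source is outside the box about the frozen plaquette
  set c₀ : Site 2 := faceAt p k₀ with hc₀def
  have hp₀far : p₀ δ ∉ sqBox c₀ ((R - 1 : ℕ) : ℤ) := fun hin => by
    have h0 : ((R - 1 : ℕ) : ℤ) + 1 ≤ (R : ℤ) + 1 := by omega
    have h1 := hcollar (p₀ δ) (sqBox_mono p h0 (sqBox_faceAt_subset p k₀ _ hin))
    linarith [hfar.2]
  -- UPPER bound at the plaquette `y`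
  have hMN : 0 < M * N δ := mul_pos hM hN
  have hyρ' : y ∈ sqBox c₀ ((ρ + 1 : ℕ) : ℤ) := by
    have := sqBox_subset_sqBox_faceAt p k₀ (ρ : ℤ) hyρ; push_cast; exact this
  have hbd : ∀ q ∈ touchPlaquettes (𝓕.Λ δ), q ∈ sqBox c₀ (((R - 1 : ℕ) : ℤ) + 1) → 𝓕.Hb δ q ≤ c δ + M * N δ := by
    intro q hq hqbox
    have h0 : ((R - 1 : ℕ) : ℤ) + 1 + 1 ≤ (R : ℤ) + 1 := by omega
    have h1 := hcollar q (sqBox_mono p h0 (sqBox_faceAt_subset p k₀ _ hqbox))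
    have := (hapriori q h1).2 hq
    rw [abs_le] at this; linarith
  have hup := hprim.hb_le_near_frozen hadj (fun _ _ => rfl) hcuts hHF hodd hcst hpΛ hk₀ (Or.inl rfl) hp₀far hMN hbd
    (show ρ + 1 ≤ R - 1 by omega) hyt hyρ'
  -- the ratios are at most `κ d`
  have hR3 : 3 ≤ R := le_trans (by omega) hρR
  have hRbig : ε₁ / (8 * δ) ≤ (R : ℝ) := by
    have h1 : ε₁ / (4 * δ) - 1 ≤ (R : ℝ) := by linarith
    have h2 : 1 ≤ ε₁ / (8 * δ) := by
      rw [le_div_iff₀ (by positivity)]; nlinarith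
    have h3 : ε₁ / (4 * δ) = 2 * (ε₁ / (8 * δ)) := by field_simp; ring
    linarith
  have hratio : ∀ x : ℝ, 0 ≤ x → x ≤ (ρ : ℝ) + 2 → ∀ z : ℝ, ε₁ / (8 * δ) ≤ z → x / z ≤ κ * d := by
    intro x _ hx z hz
    rw [hκ]
    exact aux_ratio_le hδ0 hC₀ hε₁ hd0 hδd hρlt hx hz
  have hr2 : ((((ρ + 1 : ℕ) : ℝ) + 1) / (((R - 1 : ℕ) : ℝ) + 1)) ≤ κ * d := by
    have e : (((R - 1 : ℕ) : ℝ) + 1) = (R : ℝ) := by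
      rw [Nat.cast_sub (by omega)]; push_cast; ring
    rw [e]
    exact hratio _ (by positivity) (by push_cast; linarith) _ hRbig
  have hpow2 : endDecayConst * endProfile (R - 1) (ρ + 1) ≤ endDecayConst * (κ * d) ^ endDecayExp :=
    mul_le_mul_of_nonneg_left (Real.rpow_le_rpow (by positivity) hr2 hγ.le) hA.le
  have hpos2 : 0 ≤ endDecayConst * endProfile (R - 1) (ρ + 1) := mul_nonneg hA.le (endProfile_pos _ _).le
  have hposκ1 : 0 ≤ beurlingConst * (κ * d) ^ beurlingExp := by positivity
  have hposκ2 : 0 ≤ endDecayConst * (κ * d) ^ endDecayExp := by positivity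
  have hX2 : endDecayConst * endProfile (R - 1) (ρ + 1) ≤ η := by linarith
  have hm2 := mul_le_mul_of_nonneg_left hX2 hMN.le
  -- conclusion
  have e1 : c δ + M * N δ * (endDecayConst * endProfile (R - 1) (ρ + 1)) ≤ c δ + η * (M * N δ) := by
    have := hm2; linarith [mul_comm (M * N δ) η]
  exact hup.trans e1

end KCSectionFamily

end Literature.Probability.LatticeModels
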